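import Mathlib
import HarnessLib

/-!
# The takeover coefficient at an axis stagnation point is a cone moment: kernel algebra and the local waist oscillator

Kernel-checked cores behind the soloist's (PL11) (HOME `paper/sharpest.md` §5.2, claim C38), continuing
`SoloBlindHouLiDefect.lean` (PL7)–(PL10).

Setting (informal; the theorems certify only the algebra/ODE statements they display). Axisymmetric flow in the
variables of Hou–Li (CPAM 61 (2008), eqs. (13)–(16)): `u₁ = u_θ/r`, `ω₁ = ω_θ/r`, `ψ₁` with `−Lψ₁ = ω₁`,
`L = ∂_r² + (3/r)∂_r + ∂_z²` = the Laplacian of `ℝ⁵ = ℝ⁴ × ℝ` on functions of `(ρ,z) = (|y'|, z)`. For flows even in `z`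
(`u₁` even; `ω₁, ψ₁` odd) the origin is a stagnation point and, with `Φ = ψ₁,z` (so `∂_z v_z|_{axis} = 2Φ`), the
Green's function `(8π²|y|³)⁻¹` of `ℝ⁵` gives on the axis `Φ(0,z) = (3/8π²) ∫ g(y_z − z; |y'|) ω₁(y) dy` with the kernel
`g(s; ρ) = s (ρ² + s²)^{-5/2}`. Differentiating twice produces the law stated in the text,

  `σ₂ := ∂_z³ v_z(0,0) = 15 · PV∫∫ zρ³(4z² − 3ρ²)(ρ² + z²)^{-9/2} ω₁ dρ dz − (6/7) ω₁,z(0,0)`,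

whose kernel changes sign on the cone `z = (√3/2) ρ` (elevation ≈ 40.9° seen from the stagnation point): positive
azimuthal vorticity BELOW the cone and the local gradient `ω₁,z(0,0) ≥ 0` make `σ₂ < 0` (the waist of a one-signed swirl
erodes), positive vorticity lifted ABOVE the cone makes `σ₂ > 0` (the waist persists). Combined with the point laws
`k' = −σ₀k + σ₂m`, `W' = −σ₀W + 2mk` (`m = u₁(0,0)`, `k = u₁,zz(0,0)`, `W = ω₁,z(0,0)`, `σ₀ = ∂_z v_z(0,0)`; inviscid parts,
verified by exact polynomial jets in HOME `work/c38_sigma2/`), the pair `(k, W)` is a damped inertial oscillator forced by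
the nonlocal cone moment `N = PV∫∫ K₂ ω₁`.

Content:
* `coneKernel_first_deriv`, `coneKernel_second_deriv` — the chain-rule cores: with `w² = ρ² + s²`, `w·w' = s` (so `w = |y|`
  along the axis direction), the first and second `s`-derivatives of `s·w⁻⁵` computed by the product/chain rule equal
  `(ρ² − 4s²)·w⁻⁷` and `5s(4s² − 3ρ²)·w⁻⁹`;
* `coneKernel_pos_iff` — for `ρ, s > 0`: `0 < 4s² − 3ρ²  ↔  (√3/2)·ρ < s` (the cone);
* `hasDerivAt_local_pair` — with `k' = −σk + (15N − (6/7)W)m` and `W' = −σW + 2mk`: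
  `(7k² + 3W²)' = −2σ(7k² + 3W²) + 210·m·k·N` (functions written as products; without the cone moment the local waist data decay exactly like `e^{-2∫σ}`
  while rotating: neither takeover nor persistence is decided locally);
* `local_pair_no_real_eigenvalue` — the homogeneous matrix `[[−σ, −(6/7)m], [2m, −σ]]` has characteristic value
  `(σ+x)² + (12/7)m² > 0` at every real `x` when `m ≠ 0` (complex pair `−σ ± i·m·√(12/7)`);
* `local_pair_forced_equilibrium` — the stationary relative curvature under constant forcing: `ρ₂(4 + ab) = 2f`.

The linter option `linter.dupNamespace` is disabled because the mandated landing namespace repeats the summit name by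
design (D-0017). [problem: ns]
-/

set_option linter.dupNamespace false

namespace Summit.NavierStokesRegularity.NavierStokesRegularity.Theorems

section KernelAlgebra

variable {K : Type*} [Field K]

/-- FIRST DERIVATIVE OF THE AXIS KERNEL (chain-rule core). Jets at a point: `w ≠ 0` with `w² = ρ² + s²` and
`w·w' = s` (the derivative of `w = (ρ² + s²)^{1/2}` in `s`). The product rule applied to `g = s · w⁻⁵` gives
`g' = w⁻⁵ + s·(−5·w⁻⁶·w')`, and this equals `(ρ² − 4s²)·w⁻⁷`. -/
theorem coneKernel_first_deriv (ρ s w w' : K) (hw : w ≠ 0) (hw2 : w ^ 2 = ρ ^ 2 + s ^ 2) (hw' : w * w' = s) :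
    (w⁻¹) ^ 5 + s * (-5 * (w⁻¹) ^ 6 * w') = (ρ ^ 2 - 4 * s ^ 2) * (w⁻¹) ^ 7 := by
  have hw'e : w' = s * w⁻¹ := by
    field_simp
    linear_combination hw'
  subst hw'e
  field_simp
  linear_combination hw2

/-- SECOND DERIVATIVE OF THE AXIS KERNEL (chain-rule core). With the same jets, differentiating
`g' = (ρ² − 4s²)·w⁻⁷` once more by the product/chain rule gives `−8s·w⁻⁷ + (ρ² − 4s²)·(−7·w⁻⁸·w')`, and this equals
`5s(4s² − 3ρ²)·w⁻⁹`: the kernel of the cone-moment law, changing sign at `4s² = 3ρ²`. -/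
theorem coneKernel_second_deriv (ρ s w w' : K) (hw : w ≠ 0) (hw2 : w ^ 2 = ρ ^ 2 + s ^ 2) (hw' : w * w' = s) :
    -8 * s * (w⁻¹) ^ 7 + (ρ ^ 2 - 4 * s ^ 2) * (-7 * (w⁻¹) ^ 8 * w') =
      5 * s * (4 * s ^ 2 - 3 * ρ ^ 2) * (w⁻¹) ^ 9 := by
  have hw'e : w' = s * w⁻¹ := by
    field_simp
    linear_combination hw'
  subst hw'e
  field_simp
  linear_combination (-8 * s) * hw2

end KernelAlgebra

/-- THE CONE. For `ρ, s > 0` the kernel factor `4s² − 3ρ²` is positive exactly when `s > (√3/2)ρ`, i.e. above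
elevation `arctan(√3/2) ≈ 40.9°` as seen from the stagnation point. -/
theorem coneKernel_pos_iff (ρ s : ℝ) (hρ : 0 < ρ) (hs : 0 < s) :
    0 < 4 * s ^ 2 - 3 * ρ ^ 2 ↔ Real.sqrt 3 / 2 * ρ < s := by
  have h3 : Real.sqrt 3 ^ 2 = 3 := Real.sq_sqrt (by norm_num)
  have h3' : 0 ≤ Real.sqrt 3 := Real.sqrt_nonneg 3
  have hpos : 0 ≤ Real.sqrt 3 / 2 * ρ := by positivity
  constructor
  · intro h
    by_contra hlt
    have hle : s ≤ Real.sqrt 3 / 2 * ρ := not_lt.mp hlt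
    have hsq : s * s ≤ (Real.sqrt 3 / 2 * ρ) * (Real.sqrt 3 / 2 * ρ) :=
      mul_self_le_mul_self (le_of_lt hs) hle
    nlinarith [hsq, h3]
  · intro h
    have hsq : (Real.sqrt 3 / 2 * ρ) * (Real.sqrt 3 / 2 * ρ) < s * s :=
      mul_self_lt_mul_self hpos h
    nlinarith [hsq, h3]

section LocalPair

/-- THE LOCAL WAIST OSCILLATOR. At an even stagnation point let `k = u₁,zz(0,0,t)`, `W = ω₁,z(0,0,t)`, `m = u₁(0,0,t)`,
`σ = ∂_z v_z(0,0,t)` and `N` the nonlocal cone moment, with the inviscid point laws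
`k' = −σk + σ₂m`, `σ₂ = 15N − (6/7)W`, and `W' = −σW + 2mk`. Then the quadratic form `Q = 7k² + 3W²` obeys
`Q' = −2σQ + 210·m·k·N`: absent the cone moment, `Q·e^{2∫σ}` is conserved — the local data rotate and decay at exactly
the rate at which `m` grows, deciding nothing; the secular trend of the waist is carried by `N`. Real functions of `t`;
products/sums of functions are pointwise. -/
theorem hasDerivAt_local_pair (k W m σ N : ℝ → ℝ) (k' W' : ℝ) (t : ℝ)
    (hk : HasDerivAt k k' t) (hW : HasDerivAt W W' t)
    (hk' : k' = -(σ t) * k t + (15 * N t - 6 / 7 * W t) * m t)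
    (hW' : W' = -(σ t) * W t + 2 * m t * k t) :
    HasDerivAt (fun s => 7 * (k s * k s) + 3 * (W s * W s))
      (-2 * σ t * (7 * (k t * k t) + 3 * (W t * W t)) + 210 * m t * k t * N t) t := by
  have e : 7 * (k' * k t + k t * k') + 3 * (W' * W t + W t * W') =
      -2 * σ t * (7 * (k t * k t) + 3 * (W t * W t)) + 210 * m t * k t * N t := by
    rw [hk', hW']
    ring
  exact (((hk.mul hk).const_mul 7).add ((hW.mul hW).const_mul 3)).congr_deriv e

/-- The homogeneous part `[[−σ, −(6/7)m], [2m, −σ]]` of the local pair has no real eigenvalue when `m ≠ 0`: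
its characteristic polynomial at a real `x` equals `(σ + x)² + (12/7)m² > 0` (eigenvalues `−σ ± i m √(12/7)`). -/
theorem local_pair_no_real_eigenvalue (σ m x : ℝ) (hm : m ≠ 0) :
    0 < (-σ - x) * (-σ - x) - (-(6 / 7) * m) * (2 * m) := by
  have hm2 : 0 < m ^ 2 := by positivity
  nlinarith [sq_nonneg (σ + x), hm2]

/-- Stationary point of the forced, strain-time-normalised pair `ρ₂' = −2ρ₂ − a·w + f`, `w' = −2w + b·ρ₂`
(`ρ₂ = k/m`, `w = W/m`, `a = (6/7)m/σ`, `b = 2m/σ`, `f = 15N/σ`): `ρ₂·(4 + ab) = 2f`, i.e.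
`ρ₂* = 30(N/σ)/(4 + (12/7)(m/σ)²)` — the sign of the persistent relative curvature is the sign of the cone moment,
and its size is suppressed by the inertial stiffness `(m/σ)²`. -/
theorem local_pair_forced_equilibrium (ρ₂ w a b f : ℝ)
    (h1 : -2 * ρ₂ - a * w + f = 0) (h2 : -2 * w + b * ρ₂ = 0) :
    ρ₂ * (4 + a * b) = 2 * f := by
  linear_combination (-2 : ℝ) * h1 + a * h2

end LocalPair

end Summit.NavierStokesRegularity.NavierStokesRegularity.Theorems
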